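import Mathlib.AlgebraicGeometry.ProjectiveSpectrum.Basic
import Mathlib.AlgebraicGeometry.IdealSheaf.Subscheme
import Mathlib.AlgebraicGeometry.Morphisms.ClosedImmersion
import HarnessLib

/-!
# Closed subschemes of `Proj A` over the basic affine opens `D₊(f)`

Bookkeeping lemmas relating Mathlib's three descriptions of the affine open `D₊(f) ⊆ Proj A`
(`f` homogeneous of positive degree; Hartshorne II Prop. 2.5(b): «`D₊(f)` is affine, isomorphic to
`Spec A_{(f)}`») — the open immersion `Proj.awayι : Spec A_{(f)} ⟶ Proj A`, the affine open
`Proj.basicOpen 𝒜 f` with its `IsAffineOpen.fromSpec`, and the section isomorphism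
`Proj.basicOpenIsoAway : A_{(f)} ≅ Γ(Proj A, D₊(f))` — and what they give for a closed subscheme
`V(𝓘) ↪ Proj A` cut out by an ideal sheaf `𝓘` (Mathlib `Scheme.IdealSheafData.subscheme`,
Hartshorne II Ex. 3.11 / Prop. 5.9): over `D₊(f)` the subscheme is `Spec (Γ(D₊(f))/𝓘(D₊(f)))`
(Mathlib `IdealSheafData.subschemeCover`) and its structure morphism to `Spec A₀` is `Spec` of
`A₀ → A_{(f)} ≅ Γ(D₊(f)) → Γ(D₊(f))/𝓘(D₊(f))` (`subschemeCover_f_subschemeι_toSpecZero`). For the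
reduced induced structure on a closed subset `Z` (`IdealSheafData.vanishingIdeal Z`,
Hartshorne II Example 3.2.6) the ideal `𝓘(D₊(f))` is the vanishing ideal of `Z ∩ D₊(f)` read in
`A_{(f)}` (`vanishingIdeal_ideal_basicOpen`), and for `Z = V₊(F)` and `f = f₁ f₂` that preimage is
the zero locus of `F f₂^{deg F·?}/f^{?}` — precisely of `awayMap (F^{deg f₁}/f₁^{deg F})`
(`awayι_mul_preimage_zeroLocus`, from Mathlib `Proj.awayι_preimage_basicOpen` and
`Proj.SpecMap_awayMap_awayι`).

## References

* R. Hartshorne, *Algebraic Geometry*, GTM 52 (1977): II Prop. 2.5(b), II Example 3.2.6,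
  II Ex. 3.11, II Prop. 5.9. [Hartshorne1977]
-/

noncomputable section

open CategoryTheory AlgebraicGeometry HomogeneousLocalization TopologicalSpace

universe u

namespace Literature.AlgebraicGeometry.Motives.ProjSubscheme

variable {R A : Type u} [CommRing R] [CommRing A] [Algebra R A] (𝒜 : ℕ → Submodule R A)
  [GradedAlgebra 𝒜]
variable {m : ℕ} (f : A) (f_deg : f ∈ 𝒜 m) (hm : 0 < m)

/-- The basic open `D₊(f)` as an affine open of `Proj A` (Mathlib `Proj.isAffineOpen_basicOpen`;
Hartshorne II Prop. 2.5(b)). [folklore] -/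
abbrev affineBasicOpen : (Proj 𝒜).affineOpens :=
  ⟨Proj.basicOpen 𝒜 f, Proj.isAffineOpen_basicOpen 𝒜 f f_deg hm⟩

/-- Unfolding: the underlying open of `affineBasicOpen` is `D₊(f)` (`rfl`). [folklore] -/
@[simp]
theorem affineBasicOpen_coe :
    (affineBasicOpen 𝒜 f f_deg hm : (Proj 𝒜).Opens) = Proj.basicOpen 𝒜 f :=
  rfl

/-- The canonical morphism `Spec Γ(Proj A, D₊(f)) → Proj A` of the affine open `D₊(f)` (Mathlib
`IsAffineOpen.fromSpec`) is `Spec` of the section isomorphism `A_{(f)} → Γ(D₊(f))` followed by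
`awayι : Spec A_{(f)} → Proj A` (Hartshorne II Prop. 2.5(b)). [folklore] -/
theorem fromSpec_affineBasicOpen :
    (affineBasicOpen 𝒜 f f_deg hm).2.fromSpec =
      Spec.map (Proj.awayToSection 𝒜 f) ≫ Proj.awayι 𝒜 f f_deg hm := by
  have key : (Proj.isAffineOpen_basicOpen 𝒜 f f_deg hm).isoSpec.hom ≫
      Spec.map (Proj.awayToSection 𝒜 f) = (Proj.basicOpenIsoSpec 𝒜 f f_deg hm).hom := by
    rw [Proj.basicOpenIsoSpec_hom, IsAffineOpen.isoSpec_hom]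
    rfl
  have hinv : Spec.map (Proj.awayToSection 𝒜 f) ≫ (Proj.basicOpenIsoSpec 𝒜 f f_deg hm).inv =
      (Proj.isAffineOpen_basicOpen 𝒜 f f_deg hm).isoSpec.inv := by
    rw [Iso.comp_inv_eq, ← key, Iso.inv_hom_id_assoc]
  calc (affineBasicOpen 𝒜 f f_deg hm).2.fromSpec
      = (Proj.isAffineOpen_basicOpen 𝒜 f f_deg hm).isoSpec.inv ≫ (Proj.basicOpen 𝒜 f).ι := rfl
    _ = (Spec.map (Proj.awayToSection 𝒜 f) ≫ (Proj.basicOpenIsoSpec 𝒜 f f_deg hm).inv) ≫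
          (Proj.basicOpen 𝒜 f).ι := by rw [hinv]
    _ = Spec.map (Proj.awayToSection 𝒜 f) ≫ Proj.awayι 𝒜 f f_deg hm := by
          rw [Category.assoc, Proj.basicOpenIsoSpec_inv_ι]

/-- Vanishing ideals and ring isomorphisms: for an isomorphism `e : B ≅ C` of commutative rings and
`T ⊆ Spec B`, the vanishing ideal of the preimage of `T` under `Spec C → Spec B` is the image under
`e` of the vanishing ideal of `T`. [folklore] -/
theorem vanishingIdeal_preimage_SpecMap_of_iso {B C : CommRingCat.{u}} (e : B ≅ C)
    (T : Set (PrimeSpectrum B)) :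
    PrimeSpectrum.vanishingIdeal ((Spec.map e.hom) ⁻¹' T) =
      Ideal.map e.hom.hom (PrimeSpectrum.vanishingIdeal T) := by
  rw [← CategoryTheory.Iso.commRingCatIsoToRingEquiv_toRingHom, Ideal.map_comap_of_equiv]
  ext s
  simp only [PrimeSpectrum.mem_vanishingIdeal, Set.mem_preimage, Ideal.mem_comap]
  constructor
  · intro H p hp
    have hq : Spec.map e.hom (Spec.map e.inv p) = p := by
      rw [← Scheme.Hom.comp_apply, ← Spec.map_comp, Iso.hom_inv_id, Spec.map_id]
      rfl
    have := H (Spec.map e.inv p) (by rwa [hq])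
    rw [Spec.map_apply, PrimeSpectrum.comap_asIdeal, Ideal.mem_comap] at this
    exact this
  · intro H q hq
    have := H _ hq
    rw [Spec.map_apply, PrimeSpectrum.comap_asIdeal, Ideal.mem_comap] at this
    change e.hom.hom (e.inv.hom s) ∈ q.asIdeal at this
    rwa [CommRingCat.hom_inv_apply] at this

/-- **The reduced structure on `Z ∩ D₊(f)`**: for a closed `Z ⊆ Proj A`, the ideal of sections over
`D₊(f)` of the vanishing ideal sheaf of `Z` (Mathlib `IdealSheafData.vanishingIdeal`, the ideal of
the reduced induced closed subscheme, Hartshorne II Example 3.2.6) is, through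
`A_{(f)} ≅ Γ(D₊(f))`, the vanishing ideal of `awayι⁻¹(Z) ⊆ Spec A_{(f)}`. [folklore] -/
theorem vanishingIdeal_ideal_affineBasicOpen (Z : Closeds (Proj 𝒜)) :
    (Scheme.IdealSheafData.vanishingIdeal Z).ideal (affineBasicOpen 𝒜 f f_deg hm) =
      Ideal.map (Proj.awayToSection 𝒜 f).hom
        (PrimeSpectrum.vanishingIdeal ((Proj.awayι 𝒜 f f_deg hm) ⁻¹' (Z : Set (Proj 𝒜)))) := by
  rw [Scheme.IdealSheafData.vanishingIdeal_ideal]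
  have hset : ((affineBasicOpen 𝒜 f f_deg hm).2.fromSpec ⁻¹' (Z : Set (Proj 𝒜))) =
      Spec.map (Proj.basicOpenIsoAway 𝒜 f f_deg hm).hom ⁻¹'
        ((Proj.awayι 𝒜 f f_deg hm) ⁻¹' (Z : Set (Proj 𝒜))) := by
    have h := fromSpec_affineBasicOpen 𝒜 f f_deg hm
    simp only [h, Proj.basicOpenIsoAway_hom]
    rfl
  exact (congrArg PrimeSpectrum.vanishingIdeal hset).trans
    (vanishingIdeal_preimage_SpecMap_of_iso (Proj.basicOpenIsoAway 𝒜 f f_deg hm) _)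

/-- The piece `Spec (Γ(X, U)/𝓘(U)) → V(𝓘)` of Mathlib's affine open cover
`IdealSheafData.subschemeCover` of the closed subscheme `V(𝓘)` of an ideal sheaf `𝓘`, with its
source written literally as `Spec` of the quotient ring (Hartshorne II Prop. 5.9: a closed subscheme
is locally `Spec (A/𝔞)`). [folklore] -/
def subschemePiece {X : Scheme.{u}} (I : X.IdealSheafData) (U : X.affineOpens) :
    Spec (CommRingCat.of (Γ(X, U) ⧸ I.ideal U)) ⟶ I.subscheme :=
  I.subschemeCover.f U

/-- The pieces of the cover are open immersions (Mathlib). [folklore] -/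
instance isOpenImmersion_subschemePiece {X : Scheme.{u}} (I : X.IdealSheafData)
    (U : X.affineOpens) : IsOpenImmersion (subschemePiece I U) :=
  I.subschemeCover.map_prop U

/-- The image of the piece over `U` is the preimage of `U` in `V(𝓘)` (Mathlib
`IdealSheafData.opensRange_subschemeCover_map`). [folklore] -/
theorem opensRange_subschemePiece {X : Scheme.{u}} (I : X.IdealSheafData) (U : X.affineOpens) :
    (subschemePiece I U).opensRange = I.subschemeι ⁻¹ᵁ (U : X.Opens) :=
  I.opensRange_subschemeCover_map U

/-- The piece over `U` followed by `V(𝓘) ↪ X` is `Spec (Γ(U)/𝓘(U)) → Spec Γ(U) = U ⊆ X` (Mathlib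
`subschemeCover_map_subschemeι`, `glueDataObjι_ι`). [folklore] -/
theorem subschemePiece_ι {X : Scheme.{u}} (I : X.IdealSheafData) (U : X.affineOpens) :
    subschemePiece I U ≫ I.subschemeι =
      Spec.map (CommRingCat.ofHom (Ideal.Quotient.mk (I.ideal U))) ≫ U.2.fromSpec :=
  (I.subschemeCover_map_subschemeι U).trans (I.glueDataObjι_ι U)

/-- **The structure morphism of a closed subscheme over `D₊(f)`**: for an ideal sheaf `𝓘` on
`Proj A`, the piece `Spec (Γ(D₊(f))/𝓘(D₊(f)))` of the closed subscheme `V(𝓘)`, followed by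
`V(𝓘) ↪ Proj A → Spec A₀`, is `Spec` of the ring map `A₀ → A_{(f)} ≅ Γ(D₊(f)) → Γ(D₊(f))/𝓘(D₊(f))`
(Hartshorne II Prop. 2.5(b) and Prop. 5.9). [folklore] -/
theorem subschemePiece_ι_toSpecZero (I : (Proj 𝒜).IdealSheafData) :
    subschemePiece I (affineBasicOpen 𝒜 f f_deg hm) ≫ I.subschemeι ≫ Proj.toSpecZero 𝒜 =
      Spec.map (CommRingCat.ofHom
        ((Ideal.Quotient.mk (I.ideal (affineBasicOpen 𝒜 f f_deg hm))).comp
          ((Proj.awayToSection 𝒜 f).hom.comp (fromZeroRingHom 𝒜 _)))) := by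
  rw [reassoc_of% subschemePiece_ι I (affineBasicOpen 𝒜 f f_deg hm),
    reassoc_of% fromSpec_affineBasicOpen 𝒜 f f_deg hm, Proj.awayι_toSpecZero, ← Spec.map_comp,
    ← Spec.map_comp]
  rfl

variable {f}
variable {m' : ℕ} {g : A} (g_deg : g ∈ 𝒜 m') {x : A} (hx : x = f * g)
  {d : ℕ} {F : A} (F_deg : F ∈ 𝒜 d) (hd : 0 < d)

include hd in
/-- `V₊(F) ∩ D₊(f)` in the coordinates of `D₊(f)`: the preimage of the projective zero locus `V₊(F)`
under `awayι : Spec A_{(f)} → Proj A` is the affine zero locus of `F^{deg f}/f^{deg F}` (the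
complement of Mathlib's `Proj.awayι_preimage_basicOpen`). [folklore] -/
theorem awayι_preimage_zeroLocus :
    (Proj.awayι 𝒜 f f_deg hm) ⁻¹' ProjectiveSpectrum.zeroLocus 𝒜 {F} =
      PrimeSpectrum.zeroLocus {Away.isLocalizationElem f_deg F_deg} := by
  ext p
  have key := congrArg (fun U : (Spec (CommRingCat.of (Away 𝒜 f))).Opens => p ∈ U)
    (Proj.awayι_preimage_basicOpen 𝒜 f_deg hm F_deg hd)
  simp only [eq_iff_iff] at key
  change (F ∉ (Proj.awayι 𝒜 f f_deg hm p).asHomogeneousIdeal ↔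
    Away.isLocalizationElem f_deg F_deg ∉ p.asIdeal) at key
  change ({F} : Set A) ⊆ _ ↔ ({Away.isLocalizationElem f_deg F_deg} : Set _) ⊆ (p.asIdeal : Set _)
  rw [Set.singleton_subset_iff, Set.singleton_subset_iff, SetLike.mem_coe, SetLike.mem_coe]
  exact not_iff_not.mp key

include hd in
/-- **`V₊(F) ∩ D₊(f g)` in the coordinates of `D₊(f g)`**: the preimage of the projective zero locus
`V₊(F)` under `awayι : Spec A_{(fg)} → Proj A` is the affine zero locus of
`awayMap (F^{deg f}/f^{deg F}) ∈ A_{(fg)}` (Mathlib: `awayι` for `fg` factors as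
`Spec (awayMap) ≫ awayι` for `f`, `Proj.SpecMap_awayMap_awayι`). [folklore] -/
theorem awayι_mul_preimage_zeroLocus :
    (Proj.awayι 𝒜 x (hx ▸ SetLike.mul_mem_graded f_deg g_deg) (hm.trans_le (m.le_add_right m')))
        ⁻¹' ProjectiveSpectrum.zeroLocus 𝒜 {F} =
      PrimeSpectrum.zeroLocus {awayMap 𝒜 g_deg hx (Away.isLocalizationElem f_deg F_deg)} := by
  rw [← Proj.SpecMap_awayMap_awayι 𝒜 f_deg hm g_deg hx, Scheme.Hom.comp_base, TopCat.coe_comp,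
    Set.preimage_comp, awayι_preimage_zeroLocus 𝒜 f_deg hm F_deg hd]
  change PrimeSpectrum.comap (CommRingCat.ofHom (awayMap 𝒜 g_deg hx)).hom ⁻¹' _ = _
  rw [PrimeSpectrum.preimage_comap_zeroLocus, Set.image_singleton]
  rfl

end Literature.AlgebraicGeometry.Motives.ProjSubscheme

end
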